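import Summits.AnomalousDissipation.AnomalousDissipation.Theorems.SolenoidalFractalHomogenisationLagrangianStepCellChainDefs
import Mathlib.Analysis.Normed.Lp.PiLp
import Mathlib.MeasureTheory.Integral.IntervalIntegral.Basic
import HarnessLib

/-!
# K1L_D `LagrangianRenormalisationStepDesign` (stmt-AnomalousDissipation-27980), `stub_cellLawV0_IS` — the EXACT ν-DEPENDENT EFFECTIVE FAMILY
# of `WCrossing.D1ExactFamily`: the truncated `ξ = 0` sideband system, its periodic linear response, the period-mean feedback, and the c-free
# physical map `psiStar` (shared definitions; reviewed; `--kind definition --supports stmt-AnomalousDissipation-27980 --as helper`)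

Summits-side DEFINITIONS file of route `SolenoidalFractalHomogenisation` (prover seat `ad-k1l-cellLawV-w1` g5), brick **T1** of the V0 architecture
note `Cruxes/LagrangianRenormalisationStep/Lines/onelevel-V0-exact-family.md` §3, ADOPTED as the definition of record of the exact family by tenure ruling
**D26-3** (planner ad-ideate-p1 g26, cell STATUS 2026-08-29T00:19:21Z) with provisos P1 (expose the scalar: this file defines the `c`-FREE map, prefactor
`ν/(4π²)`), P2 (domain: total definition, `0` off `ν > 0`; the D1 glue chooses the window `ν ∈ (0, ν₁]`), P3 (`Re` + a conjugation-symmetry lemma later),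
P4 (this file before T2/T3/T7).  Definitions with bodies and unfolding lemmas only; no theorems of substance, no named facts, no sorry.

THE OBJECTS (lattice coordinates of `…CellChainDefs`: for the cell word `W₁` — for D1, `W₁ = (cubatureWord.stretch MB).stretch (1/ν)` — the chain of a
weak solution in the class `k = ℓ + n·z` reads `y_z' = −4π² P_{z+ξ} T_{𝔸ᵀ}(z+ξ) y_z − Σⱼ 2πi(êⱼ·(z+ξ)) envⱼ(t) [αⱼ P y_{z−mⱼ} + ᾱⱼ P y_{z+mⱼ}]`, `ξ = ℓ/n`;
at `ξ = 0` the fast block (`z ≠ 0`) is the mean-zero `n = 1` cell chain and the slow mode enters only through sources linear in `ξ`):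
* `box R` — the retained sideband lattice points `0 < ‖z‖_∞ ≤ R`; `Space R := PiLp 2 (fun _ : box R => ℂ³)` — the truncated fast state space
  (a finite-dimensional real inner-product space); `coordL` — the amplitude at a lattice point (zero off the box);
* `slotEnvelope W₁ j t` — the trapezoid envelope of slot `j` at time `t` (the time factor of `CellChain.linkCoeff`); `slotAmp W₁ j = αⱼ = e^{iφⱼ}/(2·(2π|mⱼ|)·i)`;
* `gen W₁ 𝔸 γ₁ R t : Space R →L[ℂ] Space R` — the `ξ = 0` fast generator truncated to the box, AUGMENTED by the damping `−γ₁(1 − P_z)` of the (dynamically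
  inert) longitudinal components and with the neighbours pre-projected, so that it is dissipative on ALL of `Space R` and agrees with the chain on
  transversal states (T3 proves `⟪gen·y, y⟫ ≤ −min(γ₁, 4π²·lo')‖y‖²`);
* `source W₁ R j t : ℂ³ →L[ℂ] Space R` — the unit source of slot `j` (`v ↦ −2πi·envⱼ(t)·(αⱼ P_{mⱼ} v at z = mⱼ, ᾱⱼ P_{−mⱼ} v at z = −mⱼ)`), the coefficient of
  `|ξ|(êⱼ·ξ̂)·y_0` in the sideband equations; `feedback W₁ R j t : Space R →L[ℂ] ℂ³` — `y ↦ 2πi·envⱼ(t)·(αⱼ y_{−mⱼ} + ᾱⱼ y_{mⱼ})`, the coefficient of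
  `|ξ|(êⱼ·ξ̂)` in the slow equation (the slow projection `P_ξ̂` is applied outside);
* `IsPeriodicResponse … j N` — `N : ℝ → (ℂ³ →L[ℝ] Space R)` is continuous on `[0,P]`, solves `N' = source + gen ∘ N` on `[0,P)` and `N P = N 0` (`P = W₁.period`);
  `response … j` — THE periodic response (by `Exists.choose`; existence = G7 `…SlowGraphLinearResponse.linearGraph_periodic_on` after ε-scaling, uniqueness =
  dissipativity: brick T2), `0` if none;
* `meanFeedback … j j' : ℂ³ →L[ℝ] ℂ³ := (1/P) ∫₀^P feedbackⱼ(t) ∘ response_{j'}(t) dt` — the matrices `M_{jj'}` of the note;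
* **`psiStar W M hM ν S : Visc4 (Fin 3)`** — for `ν > 0`: `W₁ = (W.stretch M).stretch (1/ν)`, `𝔸 = ν•S`, `γ₁ = 1`, `R = R0 ν = ⌈ν⁻³⌉₊`, and
  `psiStar i a l b = (ν/(4π²)) · Σ_{j,j'} ê_{j'}·a-component · êⱼ·b-component · Re((M_{jj'} e_l)_i)` — the index placement that makes
  `T_{(psiStar)ᵀ}(q) z = (ν/(4π²)) Σ_{jj'} (êⱼ·q)(ê_{j'}·q) (Re M_{jj'}) z` (`Torus.symbT_apply`, `majorTranspose`), i.e. `4π²·(1/ν)·P_q T_{psiStarᵀ}(q) P_q` = the period mean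
  of the `ξ → 0` fast feedback into the slow mode per `|ξ|²`; `0` for `ν ≤ 0`.  The D1 glue takes `Ψ_a ν := (a/a⋆)•psiStar … ν` on `(0, ν₁]`, `c := a⋆/a` (P1/P2).
NOT a proof of anything; rung F-D1.A0 infrastructure.  AD is not proved.
-/

set_option linter.dupNamespace false

noncomputable section

namespace Summit.AnomalousDissipation.AnomalousDissipation.Theorems.SolenoidalFractalHomogenisation.LagrangianStep.Sideband

open Set MeasureTheory Complex UnitAddTorus
open scoped InnerProductSpace
open Literature.Analysis Literature.Analysis.FunctionSpaces Literature.Analysis.FunctionSpaces.Torus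
open Literature.Analysis.FluidPDE Literature.Analysis.FluidPDE.Torus Literature.Analysis.FluidPDE.LatticeShear
open Summit.AnomalousDissipation.AnomalousDissipation.Theorems.SolenoidalFractalHomogenisation.LagrangianStep.CellChain (linkCoeff)

variable {k₀ : ℕ}

/-! ## §1 The truncated sideband lattice and its state space -/

/-- **The retained sideband lattice points**: `z ∈ ℤ³`, `z ≠ 0`, `|zᵢ| ≤ R` (sup-norm box of radius `R` without the origin = the slow mode).
[cite: MajdaKramer1999, §2.2.1.3 (cell problem (49), periodic corrector)] -/
def box (R : ℕ) : Finset (Fin 3 → ℤ) :=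
  (Fintype.piFinset fun _ : Fin 3 => Finset.Icc (-(R : ℤ)) R).filter (fun z => z ≠ 0)

/-- Membership in the box. [cite: MajdaKramer1999, §2.2.1.3] -/
theorem mem_box {R : ℕ} {z : Fin 3 → ℤ} : z ∈ box R ↔ (∀ i, -(R : ℤ) ≤ z i ∧ z i ≤ R) ∧ z ≠ 0 := by
  simp [box, Fintype.mem_piFinset]

/-- **The truncated fast state space**: one `ℂ³` amplitude per retained lattice point, with the `ℓ²` (Parseval) norm; a finite-dimensional
complex — hence real — inner-product space. [cite: MajdaKramer1999, §2.2.1.3] -/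
abbrev Space (R : ℕ) : Type := PiLp 2 (fun _ : box R => EuclideanSpace ℂ (Fin 3))

/-- **The amplitude at the lattice point `z`** as a continuous linear map (`0` if `z` is not retained). [cite: MajdaKramer1999, §2.2.1.3] -/
def coordL (R : ℕ) (z : Fin 3 → ℤ) : Space R →L[ℂ] EuclideanSpace ℂ (Fin 3) :=
  if h : z ∈ box R then PiLp.proj 2 (fun _ : box R => EuclideanSpace ℂ (Fin 3)) ⟨z, h⟩ else 0

/-- Unfolding `coordL` on the box. [cite: MajdaKramer1999, §2.2.1.3] -/
theorem coordL_apply_of_mem {R : ℕ} {z : Fin 3 → ℤ} (h : z ∈ box R) (y : Space R) : coordL R z y = y ⟨z, h⟩ := by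
  simp [coordL, h]

/-- Unfolding `coordL` off the box. [cite: MajdaKramer1999, §2.2.1.3] -/
theorem coordL_apply_of_not_mem {R : ℕ} {z : Fin 3 → ℤ} (h : z ∉ box R) (y : Space R) : coordL R z y = 0 := by
  simp [coordL, h]

/-! ## §2 The slot data: envelope and complex amplitude -/

/-- **The envelope of slot `j` at time `t`**: `trapⱼ(fract(t/P)·P)` (the time factor of `CellChain.linkCoeff`; continuous and `P`-periodic).
[cite: ArmstrongVicol2025, §4 p. 17 (time cutoff)] -/
def slotEnvelope (W₁ : LatticeWord k₀) (j : Fin k₀) (t : ℝ) : ℝ :=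
  LatticeWord.trapezoid (W₁.start j) (W₁.phase j).τ W₁.ramp (Int.fract (t / W₁.period) * W₁.period)

/-- Unfolding `slotEnvelope`. [cite: ArmstrongVicol2025, §4 p. 17 (time cutoff)] -/
theorem slotEnvelope_def (W₁ : LatticeWord k₀) (j : Fin k₀) (t : ℝ) :
    slotEnvelope W₁ j t = LatticeWord.trapezoid (W₁.start j) (W₁.phase j).τ W₁.ramp (Int.fract (t / W₁.period) * W₁.period) := rfl

/-- `CellChain.linkCoeff W₁ n k j t = 2πi (êⱼ·k) · ((1/n)·slotEnvelope W₁ j t)`. [cite: MeshalkinSinai1961, pp. 1700–1705] -/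
theorem linkCoeff_eq (W₁ : LatticeWord k₀) (n : ℕ) (k : Fin 3 → ℤ) (j : Fin k₀) (t : ℝ) :
    linkCoeff W₁ n k j t = 2 * Real.pi * Complex.I * (∑ a, ((W₁.phase j).e a : ℂ) * (k a)) * (((1 / (n : ℝ)) * slotEnvelope W₁ j t : ℝ) : ℂ) := rfl

/-- **The complex layer amplitude of slot `j`**: `αⱼ = e^{iφⱼ}·(1/(2·(2π|mⱼ|)·i))` (as written out in `CellChain.modeRHS`; `ᾱⱼ = conj αⱼ` is the
coefficient of the `+Kⱼ` neighbour). [cite: MeshalkinSinai1961, pp. 1700–1705] -/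
def slotAmp (W₁ : LatticeWord k₀) (j : Fin k₀) : ℂ :=
  Complex.exp ((W₁.phase j).φ * Complex.I) * (1 / (2 * ((2 * Real.pi * ‖latticeVec (W₁.phase j).m‖ : ℝ) : ℂ) * Complex.I))

/-- Unfolding `slotAmp`. [cite: MeshalkinSinai1961, pp. 1700–1705] -/
theorem slotAmp_def (W₁ : LatticeWord k₀) (j : Fin k₀) :
    slotAmp W₁ j = Complex.exp ((W₁.phase j).φ * Complex.I) * (1 / (2 * ((2 * Real.pi * ‖latticeVec (W₁.phase j).m‖ : ℝ) : ℂ) * Complex.I)) := rfl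

/-- The `+Kⱼ`-neighbour coefficient of `CellChain.modeRHS` is `conj (slotAmp)`. [cite: MeshalkinSinai1961, pp. 1700–1705] -/
theorem conj_slotAmp (W₁ : LatticeWord k₀) (j : Fin k₀) :
    starRingEnd ℂ (slotAmp W₁ j) = starRingEnd ℂ (Complex.exp ((W₁.phase j).φ * Complex.I)) *
      (-(1 / (2 * ((2 * Real.pi * ‖latticeVec (W₁.phase j).m‖ : ℝ) : ℂ) * Complex.I))) := by
  rw [slotAmp_def, map_mul]
  congr 1
  simp [Complex.conj_ofReal, Complex.conj_I, map_ofNat]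

/-! ## §3 The truncated `ξ = 0` fast generator, the unit sources and the feedback functionals -/

/-- **The `z`-component of the augmented truncated `ξ = 0` fast generator**:
`y ↦ −4π² P_z T_{𝔸ᵀ}(z) P_z y_z − γ₁ (y_z − P_z y_z) − Σⱼ linkCoeffⱼ(z,t) • P_z (αⱼ P_{z−mⱼ} y_{z−mⱼ} + ᾱⱼ P_{z+mⱼ} y_{z+mⱼ})` (`linkCoeff` at `n = 1`;
neighbours outside the box read as `0`). [cite: MajdaKramer1999, §2.2.1.3 (cell problem (49))] [cite: MeshalkinSinai1961, pp. 1700–1705] -/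
def genComp (W₁ : LatticeWord k₀) (𝔸 : Torus.Visc4 (Fin 3)) (γ₁ : ℝ) (R : ℕ) (t : ℝ) (z : box R) :
    Space R →L[ℂ] EuclideanSpace ℂ (Fin 3) :=
  -((((4 * Real.pi ^ 2 : ℝ) : ℂ)) • ((transversalProj z.1).comp ((symbTL (Torus.majorTranspose 𝔸) z.1).comp
      ((transversalProj z.1).comp (coordL R z.1))))) -
    ((γ₁ : ℝ) : ℂ) • (coordL R z.1 - (transversalProj z.1).comp (coordL R z.1)) -
    ∑ j, linkCoeff W₁ 1 z.1 j t • ((transversalProj z.1).comp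
      (slotAmp W₁ j • ((transversalProj (z.1 - (W₁.phase j).m)).comp (coordL R (z.1 - (W₁.phase j).m))) +
        starRingEnd ℂ (slotAmp W₁ j) • ((transversalProj (z.1 + (W₁.phase j).m)).comp (coordL R (z.1 + (W₁.phase j).m)))))

/-- **The augmented truncated `ξ = 0` fast generator** `gen … t : Space R →L[ℂ] Space R` (components `genComp`). [cite: MajdaKramer1999, §2.2.1.3] -/
def gen (W₁ : LatticeWord k₀) (𝔸 : Torus.Visc4 (Fin 3)) (γ₁ : ℝ) (R : ℕ) (t : ℝ) : Space R →L[ℂ] Space R :=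
  ((PiLp.continuousLinearEquiv 2 ℂ (fun _ : box R => EuclideanSpace ℂ (Fin 3))).symm : (box R → EuclideanSpace ℂ (Fin 3)) →L[ℂ] Space R).comp
    (ContinuousLinearMap.pi fun z => genComp W₁ 𝔸 γ₁ R t z)

/-- Components of `gen`. [cite: MajdaKramer1999, §2.2.1.3] -/
theorem gen_apply (W₁ : LatticeWord k₀) (𝔸 : Torus.Visc4 (Fin 3)) (γ₁ : ℝ) (R : ℕ) (t : ℝ) (y : Space R) (z : box R) :
    gen W₁ 𝔸 γ₁ R t y z = genComp W₁ 𝔸 γ₁ R t z y := by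
  simp [gen]

/-- **The `z`-component of the unit source of slot `j`**: `−2πi·envⱼ(t)·αⱼ·P_{mⱼ} v` at `z = mⱼ`, `−2πi·envⱼ(t)·ᾱⱼ·P_{−mⱼ} v` at `z = −mⱼ`, else `0`
(the coefficient of `|ξ|(êⱼ·ξ̂)·y_0` in the sideband equations at `ξ → 0`). [cite: MajdaKramer1999, §2.2.1.3 (cell problem (49), source term)] -/
def sourceComp (W₁ : LatticeWord k₀) (R : ℕ) (j : Fin k₀) (t : ℝ) (z : box R) : EuclideanSpace ℂ (Fin 3) →L[ℂ] EuclideanSpace ℂ (Fin 3) :=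
  (if z.1 = (W₁.phase j).m then (-(2 * Real.pi * Complex.I * ((slotEnvelope W₁ j t : ℝ) : ℂ) * slotAmp W₁ j)) • transversalProj z.1 else 0) +
  (if z.1 = -(W₁.phase j).m then (-(2 * Real.pi * Complex.I * ((slotEnvelope W₁ j t : ℝ) : ℂ) * starRingEnd ℂ (slotAmp W₁ j))) • transversalProj z.1
    else 0)

/-- **The unit source of slot `j`** `source … j t : ℂ³ →L[ℂ] Space R`. [cite: MajdaKramer1999, §2.2.1.3] -/
def source (W₁ : LatticeWord k₀) (R : ℕ) (j : Fin k₀) (t : ℝ) : EuclideanSpace ℂ (Fin 3) →L[ℂ] Space R :=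
  ((PiLp.continuousLinearEquiv 2 ℂ (fun _ : box R => EuclideanSpace ℂ (Fin 3))).symm : (box R → EuclideanSpace ℂ (Fin 3)) →L[ℂ] Space R).comp
    (ContinuousLinearMap.pi fun z => sourceComp W₁ R j t z)

/-- Components of `source`. [cite: MajdaKramer1999, §2.2.1.3] -/
theorem source_apply (W₁ : LatticeWord k₀) (R : ℕ) (j : Fin k₀) (t : ℝ) (v : EuclideanSpace ℂ (Fin 3)) (z : box R) :
    source W₁ R j t v z = sourceComp W₁ R j t z v := by
  simp [source]

/-- **The feedback functional of slot `j`** `y ↦ 2πi·envⱼ(t)·(αⱼ·y_{−mⱼ} + ᾱⱼ·y_{mⱼ})` (the coefficient of `−|ξ|(êⱼ·ξ̂)` in the slow equation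
before the slow projection `P_ξ̂`). [cite: MajdaKramer1999, §2.2.1.3 (55) (effective diffusivity as a cell average)] -/
def feedback (W₁ : LatticeWord k₀) (R : ℕ) (j : Fin k₀) (t : ℝ) : Space R →L[ℂ] EuclideanSpace ℂ (Fin 3) :=
  (2 * Real.pi * Complex.I * ((slotEnvelope W₁ j t : ℝ) : ℂ)) •
    (slotAmp W₁ j • coordL R (-(W₁.phase j).m) + starRingEnd ℂ (slotAmp W₁ j) • coordL R (W₁.phase j).m)

/-! ## §4 The periodic linear response and the period-mean feedback matrices -/

/-- **Periodic linear response of slot `j`**: `N` is continuous on `[0,P]`, solves `N' = sourceⱼ + gen ∘ N` on `[0,P)` (real derivative of a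
`(ℂ³ →L[ℝ] Space R)`-valued curve) and closes up, `N P = N 0` (`P = W₁.period`). [cite: SandersVerhulstMurdock2007, Lemma 5.2.7 (linear case)] -/
def IsPeriodicResponse (W₁ : LatticeWord k₀) (𝔸 : Torus.Visc4 (Fin 3)) (γ₁ : ℝ) (R : ℕ) (j : Fin k₀)
    (N : ℝ → (EuclideanSpace ℂ (Fin 3) →L[ℝ] Space R)) : Prop :=
  ContinuousOn N (Icc 0 W₁.period) ∧
  (∀ t ∈ Ico 0 W₁.period, HasDerivAt N ((source W₁ R j t).restrictScalars ℝ + ((gen W₁ 𝔸 γ₁ R t).restrictScalars ℝ).comp (N t)) t) ∧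
  N W₁.period = N 0

/-- **THE periodic linear response of slot `j`** (the one that exists and is unique by brick T2: G7 `linearGraph_periodic_on` after ε-scaling of the
source, dissipativity of `gen`; `0` if there is none, e.g. off `ν > 0`). [cite: SandersVerhulstMurdock2007, Lemma 5.2.7 (linear case)] -/
def response (W₁ : LatticeWord k₀) (𝔸 : Torus.Visc4 (Fin 3)) (γ₁ : ℝ) (R : ℕ) (j : Fin k₀) :
    ℝ → (EuclideanSpace ℂ (Fin 3) →L[ℝ] Space R) :=
  open Classical in
  if h : ∃ N, IsPeriodicResponse W₁ 𝔸 γ₁ R j N then h.choose else 0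

/-- The chosen response is a periodic response whenever one exists. [cite: SandersVerhulstMurdock2007, Lemma 5.2.7 (linear case)] -/
theorem isPeriodicResponse_response {W₁ : LatticeWord k₀} {𝔸 : Torus.Visc4 (Fin 3)} {γ₁ : ℝ} {R : ℕ} {j : Fin k₀}
    (h : ∃ N, IsPeriodicResponse W₁ 𝔸 γ₁ R j N) : IsPeriodicResponse W₁ 𝔸 γ₁ R j (response W₁ 𝔸 γ₁ R j) := by
  classical
  rw [response, dif_pos h]
  exact h.choose_spec

/-- **The period-mean feedback matrix** `M_{jj'} := (1/P) ∫₀^P feedbackⱼ(t) ∘ response_{j'}(t) dt : ℂ³ →L[ℝ] ℂ³`.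
[cite: MajdaKramer1999, §2.2.1.3 (55) (effective diffusivity as a cell average)] -/
def meanFeedback (W₁ : LatticeWord k₀) (𝔸 : Torus.Visc4 (Fin 3)) (γ₁ : ℝ) (R : ℕ) (j j' : Fin k₀) :
    EuclideanSpace ℂ (Fin 3) →L[ℝ] EuclideanSpace ℂ (Fin 3) :=
  (1 / W₁.period) • ∫ t in (0:ℝ)..W₁.period, ((feedback W₁ R j t).restrictScalars ℝ).comp (response W₁ 𝔸 γ₁ R j' t)

/-! ## §5 The c-free exact effective map `psiStar` -/

/-- **The truncation radius** `R₀(ν) = ⌈ν⁻³⌉₊` (truncation error `e^{−cνR₀}` super-algebraically small; tenure D26-3). [cite: MajdaKramer1999, §2.2.1.3] -/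
def R0 (ν : ℝ) : ℕ := ⌈(1 / ν) ^ 3⌉₊

/-- **The c-free exact effective map of the word `W` at pre-stretch `M`** (definition of record D26-3 of the family of `WCrossing.D1ExactFamily`, up to
the normalisation `Ψ_a = (a/a⋆)•psiStar`, `c = a⋆/a`): for `ν > 0`, with `W₁ = (W.stretch M).stretch (1/ν)`, `𝔸 = ν•S`, `γ₁ = 1`, `R = R0 ν`,
`psiStar i a l b = (ν/(4π²)) · Σ_{j j'} (ê_{j'})_a (êⱼ)_b · Re ((M_{jj'} e_l)_i)`, so that `T_{psiStarᵀ}(q) z = (ν/(4π²)) Σ_{jj'} (êⱼ·q)(ê_{j'}·q) (Re M_{jj'}) z`;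
`0` for `ν ≤ 0`. [cite: MajdaKramer1999, §2.2.1.3 (55) (effective diffusivity)] [cite: ArmstrongVicol2025, §3 (renormalised diffusivity of one level)] -/
def psiStar (W : LatticeWord k₀) (M : ℝ) (hM : 0 < M) (ν : ℝ) (S : Torus.Visc4 (Fin 3)) : Torus.Visc4 (Fin 3) :=
  if hν : 0 < ν then
    fun i a l b => ν / (4 * Real.pi ^ 2) * ∑ j : Fin k₀, ∑ j' : Fin k₀,
      (((W.stretch M hM).stretch (1 / ν) (one_div_pos.mpr hν)).phase j').e a *
      (((W.stretch M hM).stretch (1 / ν) (one_div_pos.mpr hν)).phase j).e b *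
      ((meanFeedback ((W.stretch M hM).stretch (1 / ν) (one_div_pos.mpr hν)) (ν • S) 1 (R0 ν) j j'
        (EuclideanSpace.single l (1:ℂ))) i).re
  else fun _ _ _ _ => 0

/-- `psiStar` vanishes off `ν > 0` (proviso P2: the D1 glue uses it only on a window `(0, ν₁]`). [cite: MajdaKramer1999, §2.2.1.3] -/
theorem psiStar_of_not_pos (W : LatticeWord k₀) (M : ℝ) (hM : 0 < M) {ν : ℝ} (hν : ¬ 0 < ν) (S : Torus.Visc4 (Fin 3)) :
    psiStar W M hM ν S = fun _ _ _ _ => 0 := by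
  simp [psiStar, hν]

/-- Unfolding `psiStar` for `ν > 0`. [cite: MajdaKramer1999, §2.2.1.3] -/
theorem psiStar_of_pos (W : LatticeWord k₀) (M : ℝ) (hM : 0 < M) {ν : ℝ} (hν : 0 < ν) (S : Torus.Visc4 (Fin 3)) (i a l b : Fin 3) :
    psiStar W M hM ν S i a l b = ν / (4 * Real.pi ^ 2) * ∑ j : Fin k₀, ∑ j' : Fin k₀,
      (((W.stretch M hM).stretch (1 / ν) (one_div_pos.mpr hν)).phase j').e a *
      (((W.stretch M hM).stretch (1 / ν) (one_div_pos.mpr hν)).phase j).e b *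
      ((meanFeedback ((W.stretch M hM).stretch (1 / ν) (one_div_pos.mpr hν)) (ν • S) 1 (R0 ν) j j'
        (EuclideanSpace.single l (1:ℂ))) i).re := by
  simp [psiStar, hν]

end Summit.AnomalousDissipation.AnomalousDissipation.Theorems.SolenoidalFractalHomogenisation.LagrangianStep.Sideband

end
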